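import Mathlib
import HarnessLib
import Summits.ValiantsHypothesis.ValiantsHypothesis.Theorems.LacunarySymmetroidMatrixDescartesProductPlusOneRowTowerKCloudTransferCert
import Summits.ValiantsHypothesis.ValiantsHypothesis.Theorems.LacunarySymmetroidMatrixDescartesProductPlusOneRowTowerKCumulant

/-!
# LINE (A) `product_plus_one` (crux `MatrixDescartes`, stmt-ValiantsHypothesis-18050, V1) — W-CB §30.5 C5, THE CLOUD TRANSFER LAW:
# ★★ on the side where `f` has the sign of its isolated BOTTOM coefficient, the order-8 image of a trinomial cloud `(+,−,−)`/`(−,+,+)`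
# is POSITIVE whenever the outer gap is at least twice the inner one (`λ₁ ≥ 3λ₀`) — such a cloud is a FREE row of the zone count

Currency: every-K θ-tower ✓ `…RowTowerKDefs` / ✓⧗ `…RowTowerKDefs8` at `n = 2` (stripped row `A − B₀x^{λ₀} − B₁x^{λ₁}`, rates `a = λ₀ < c = λ₁`,
gap `g = c − a`); order-8 image `ψ₇ − e₁ψ₅ + e₂ψ₃ − e₃ψ₁`, `eᵢ` the elementary symmetric functions of `a², g², c²` (`= L₃(θ²)ψ₁` of memo §28/§30,
`L₃(t) = (t − a²)(t − g²)(t − c²)`; `ψ₁ = −θ² log|f|` is the row's term of `S = −W(P)/P²`, ✓ `logWronskian_rowK_eq_rowPsiK1`).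

* §1 `rowPsiK5_neg`, `rowPsiK7_neg` (with ✓ `…RowTowerKCumulant`'s `rowHK_neg`, `rowUK_neg`, `rowPsiK1_neg`, `rowPsiK3_neg`) — the odd slopes are
  invariant under `(A, B) ↦ (−A, −B)` (so `(−,+,+)` is `(+,−,−)`).
* §2 `slowPole_bracket_pos` — `D⁴F₂ − APD²F₃ + A²P²F₄ > 0` for `A, P > 0`, `D ≠ 0`, `a > 0`, `c ≥ 3a` (`F₂ = 6a⁴(c−2a)(c−3a)(c+a)(c+2a)`,
  `F₃ = 240a⁶(c−3a)(c+2a)`, `F₄ = 5040a⁸`; `4F₄·(…) = (2F₄AP − F₃D²)² + a¹²(c−3a)(c+2a)(483840a² + 316800a(c−3a) + 63360(c−3a)²)·D⁴`) — the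
  positivity of the slow-POLE image (pen memo §32.2: «positive-definite for x > 2, discriminant < 0»; at `c = 3a` it is `5040a⁸A²P²`).
* §3 ★★ `rowPsiK_image8_pos_of_cloud_bottom` — `0 < λ₀`, `3λ₀ ≤ λ₁`, `0 < x`, `0 < A`, `0 < B₀`, `0 < B₁`, `0 < A − B₀x^{λ₀} − B₁x^{λ₁}` ⇒ image `> 0`:
  by ★ `rowPsiK_image8_two_transfer` (✓⧗ `…CloudTransferCert`) the image times `F⁸(A−P)⁸ > 0` is `A²P²·(§2 bracket)·F⁸ + Σ E_{mk} P^m Q^{k+1} (A−P)^{8−m} F^{7−k}`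
  with every `E_{mk} ∈ ℕ[a, c−a]`, and `A − P > Q > 0` — `positivity`.  ★★ `rowPsiK_image8_pos_of_cloud_bottom'` — the same with the sign-symmetric
  hypotheses `0 < A·B₀`, `0 < A·B₁`, `0 < A·f(x)` (both orientations, via §1).
READING (memo §30.2 table / p3 (N3) C6): the `(+,−,−)` cloud («T5») is FREE (charge 0) on its unswitched side in the whole L₃ regime `g ≥ 2a` — now a theorem,
every support, every `μ`; located complement (not claimed): its switched side carries charge 2–4, and for `a < g < 2a` (Λ₄♯ regime) the L₃-image of the
unswitched side does change sign (p5 g16 C5 sweep: 374/8873 negatives, all at `g/a < 2`).  The top-isolated cloud `(+,+,−)` on its pole side is the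
mirror statement (inner letter of rate `g`, gap `a`); it is NOT this file (the tower currency is orientation-bound; separate certificate).

HONEST FRAMING: a per-row SIGN LAW (helper) for the order-8 zone count of memo §30; it closes no stub; `WronskianBudgetK3` / `OneChangeFloorK3` / 18050 /
`MatrixDescartes` OPEN; `VP ≠ VNP` is NOT proved.  No definitions, no named facts, no sorry; Mathlib + ✓ lane modules only.
-/

set_option linter.dupNamespace false

namespace Summit.ValiantsHypothesis.ValiantsHypothesis.Theorems.LacunarySymmetroidMatrixDescartes

namespace ProductPlusOne

open Finset
open scoped BigOperators

variable {n : ℕ}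

/-! ### §1 Sign symmetry of the tower (continuing ✓ `…RowTowerKCumulant`: `rowHK_neg`, `rowUK_neg`, `rowPsiK1_neg`, `rowPsiK3_neg`) -/

/-- `ψ₅(−A, −B) = ψ₅(A, B)`. [this file's lemma] -/
theorem rowPsiK5_neg (lam : Fin n → ℕ) (A : ℝ) (B : Fin n → ℝ) (x : ℝ) :
    rowPsiK5 lam (-A) (fun l => -B l) x = rowPsiK5 lam A B x := by
  simp only [rowPsiK5, rowHK_neg, rowUK_neg]; ring

/-- `ψ₇(−A, −B) = ψ₇(A, B)`. [this file's lemma] -/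
theorem rowPsiK7_neg (lam : Fin n → ℕ) (A : ℝ) (B : Fin n → ℝ) (x : ℝ) :
    rowPsiK7 lam (-A) (fun l => -B l) x = rowPsiK7 lam A B x := by
  simp only [rowPsiK7, rowHK_neg, rowUK_neg]; ring

/-! ### §2 The slow-pole image is positive when `c ≥ 3a` -/

/-- **Slow-pole bracket.** `a > 0`, `3a ≤ c`, `A, P > 0`, `D ≠ 0` ⇒ `D⁴·6a⁴(c−2a)(c−3a)(c+a)(c+2a) − APD²·240a⁶(c−3a)(c+2a) + A²P²·5040a⁸ > 0`
(`4F₄·(…) = (2F₄AP − F₃D²)² + (4F₂F₄ − F₃²)D⁴`, `4F₂F₄ − F₃² = a¹²(c−3a)(c+2a)(483840a² + 316800a(c−3a) + 63360(c−3a)²) ≥ 0`;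
pen memo §32.2). [this file's lemma] -/
theorem slowPole_bracket_pos (a c A P D : ℝ) (ha : 0 < a) (hc : 3 * a ≤ c) (hA : 0 < A) (hP : 0 < P) (hD : D ≠ 0) :
    0 < D ^ 4 * (6 * a ^ 4 * (c - 2 * a) * (c - 3 * a) * (c + a) * (c + 2 * a))
        - A * P * D ^ 2 * (240 * a ^ 6 * (c - 3 * a) * (c + 2 * a)) + A ^ 2 * P ^ 2 * (5040 * a ^ 8) := by
  have hs : 0 ≤ c - 3 * a := by linarith
  have hD2 : 0 < D ^ 2 := by positivity
  have key : 4 * (5040 * a ^ 8) * (D ^ 4 * (6 * a ^ 4 * (c - 2 * a) * (c - 3 * a) * (c + a) * (c + 2 * a))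
        - A * P * D ^ 2 * (240 * a ^ 6 * (c - 3 * a) * (c + 2 * a)) + A ^ 2 * P ^ 2 * (5040 * a ^ 8))
      = (2 * (5040 * a ^ 8) * (A * P) - 240 * a ^ 6 * (c - 3 * a) * (c + 2 * a) * D ^ 2) ^ 2
        + a ^ 12 * (c - 3 * a) * (c + 2 * a) * (483840 * a ^ 2 + 316800 * a * (c - 3 * a) + 63360 * (c - 3 * a) ^ 2)
          * (D ^ 2) ^ 2 := by ring
  have hsq : 0 < (2 * (5040 * a ^ 8) * (A * P) - 240 * a ^ 6 * (c - 3 * a) * (c + 2 * a) * D ^ 2) ^ 2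
        + a ^ 12 * (c - 3 * a) * (c + 2 * a) * (483840 * a ^ 2 + 316800 * a * (c - 3 * a) + 63360 * (c - 3 * a) ^ 2)
          * (D ^ 2) ^ 2 := by
    rcases hs.eq_or_lt with h0 | hpos
    · rw [← h0]
      have h1 : 0 < 2 * (5040 * a ^ 8) * (A * P) := by positivity
      have h2 : (2 * (5040 * a ^ 8) * (A * P) - 240 * a ^ 6 * 0 * (c + 2 * a) * D ^ 2) ^ 2 = (2 * (5040 * a ^ 8) * (A * P)) ^ 2 := by
        ring
      rw [h2]
      have h3 : a ^ 12 * 0 * (c + 2 * a) * (483840 * a ^ 2 + 316800 * a * 0 + 63360 * 0 ^ 2) * (D ^ 2) ^ 2 = 0 := by ring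
      rw [h3, add_zero]
      positivity
    · have hc2 : 0 < c + 2 * a := by linarith
      have h1 : 0 < a ^ 12 * (c - 3 * a) * (c + 2 * a) * (483840 * a ^ 2 + 316800 * a * (c - 3 * a) + 63360 * (c - 3 * a) ^ 2)
          * (D ^ 2) ^ 2 := by positivity
      nlinarith [sq_nonneg (2 * (5040 * a ^ 8) * (A * P) - 240 * a ^ 6 * (c - 3 * a) * (c + 2 * a) * D ^ 2)]
  have h4 : (0 : ℝ) < 4 * (5040 * a ^ 8) := by positivity
  rw [← key] at hsq
  exact (mul_pos_iff_of_pos_left h4).mp hsq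

/-! ### §3 The cloud transfer law -/

/-- ★★ **CLOUD TRANSFER LAW (bottom-isolated side, `A > 0` orientation).**  Tail `n = 2` with rates `0 < λ₀`, `3λ₀ ≤ λ₁`; `0 < x`; `0 < A`, `0 < B₀`,
`0 < B₁` (the row `A − B₀x^{λ₀} − B₁x^{λ₁}` is a `(+,−,−)` cloud in stripped form) and `0 < A − B₀x^{λ₀} − B₁x^{λ₁}` (unswitched side).  Then the
order-8 image `ψ₇ − e₁ψ₅ + e₂ψ₃ − e₃ψ₁` (`eᵢ` of `λ₀², (λ₁−λ₀)², λ₁²`) is POSITIVE. [this file's theorem] -/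
theorem rowPsiK_image8_pos_of_cloud_bottom (lam : Fin 2 → ℕ) (h0 : 0 < lam 0) (h3 : 3 * lam 0 ≤ lam 1)
    (A : ℝ) (B : Fin 2 → ℝ) {x : ℝ} (hx : 0 < x) (hA : 0 < A) (hB0 : 0 < B 0) (hB1 : 0 < B 1)
    (hF : 0 < A - B 0 * x ^ lam 0 - B 1 * x ^ lam 1) :
    0 < rowPsiK7 lam A B x - ((lam 0 : ℝ) ^ 2 + ((lam 1 : ℝ) - lam 0) ^ 2 + (lam 1 : ℝ) ^ 2) * rowPsiK5 lam A B x
          + ((lam 0 : ℝ) ^ 2 * ((lam 1 : ℝ) - lam 0) ^ 2 + (lam 0 : ℝ) ^ 2 * (lam 1 : ℝ) ^ 2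
              + ((lam 1 : ℝ) - lam 0) ^ 2 * (lam 1 : ℝ) ^ 2) * rowPsiK3 lam A B x
          - ((lam 0 : ℝ) ^ 2 * ((lam 1 : ℝ) - lam 0) ^ 2 * (lam 1 : ℝ) ^ 2) * rowPsiK1 lam A B x := by
  obtain ⟨a, ha⟩ : ∃ a : ℝ, (lam 0 : ℝ) = a := ⟨_, rfl⟩
  obtain ⟨c, hc⟩ : ∃ c : ℝ, (lam 1 : ℝ) = c := ⟨_, rfl⟩
  obtain ⟨P, hP⟩ : ∃ P : ℝ, B 0 * x ^ lam 0 = P := ⟨_, rfl⟩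
  obtain ⟨Q, hQ⟩ : ∃ Q : ℝ, B 1 * x ^ lam 1 = Q := ⟨_, rfl⟩
  have hapos : 0 < a := by rw [← ha]; exact_mod_cast h0
  have hca : 3 * a ≤ c := by rw [← ha, ← hc]; exact_mod_cast h3
  have hg : 0 ≤ c - a := by linarith
  have hPpos : 0 < P := by rw [← hP]; positivity
  have hQpos : 0 < Q := by rw [← hQ]; positivity
  rw [hP, hQ] at hF
  have hD : 0 < A - P := by linarith
  obtain ⟨W, hW⟩ : ∃ W : ℝ, W = (A - P) ^ 4 * (6 * a ^ 4 * (c - 2 * a) * (c - 3 * a) * (c + a) * (c + 2 * a))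
      - A * P * (A - P) ^ 2 * (240 * a ^ 6 * (c - 3 * a) * (c + 2 * a)) + A ^ 2 * P ^ 2 * (5040 * a ^ 8) := ⟨_, rfl⟩
  have hWpos : 0 < W := by rw [hW]; exact slowPole_bracket_pos a c A P (A - P) hapos hca hA hPpos hD.ne'
  have key := rowPsiK_image8_two_transfer lam A B x a c P Q ha hc hP hQ hF.ne' W hW
  have hprod : 0 < (rowPsiK7 lam A B x - (a ^ 2 + (c - a) ^ 2 + c ^ 2) * rowPsiK5 lam A B x
        + (a ^ 2 * (c - a) ^ 2 + a ^ 2 * c ^ 2 + (c - a) ^ 2 * c ^ 2) * rowPsiK3 lam A B x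
        - (a ^ 2 * (c - a) ^ 2 * c ^ 2) * rowPsiK1 lam A B x) * (A - P - Q) ^ 8 * (A - P) ^ 8 := by
    rw [key]
    clear key hW hca h0 h3 ha hc hP hQ hB0 hB1 hx
    positivity
  have hden : 0 < (A - P - Q) ^ 8 * (A - P) ^ 8 := by positivity
  rw [mul_assoc] at hprod
  have himg := (mul_pos_iff_of_pos_right hden).mp hprod
  rw [ha, hc]
  exact himg

/-- ★★ **CLOUD TRANSFER LAW, sign-symmetric form.**  As ★★ `rowPsiK_image8_pos_of_cloud_bottom` with the hypotheses `0 < A·B₀`, `0 < A·B₁`,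
`0 < A·(A − B₀x^{λ₀} − B₁x^{λ₁})` — i.e. a `(+,−,−)` OR `(−,+,+)` cloud at a point where `f` has the sign of its isolated bottom coefficient
(via the sign symmetry of §1). [this file's theorem] -/
theorem rowPsiK_image8_pos_of_cloud_bottom' (lam : Fin 2 → ℕ) (h0 : 0 < lam 0) (h3 : 3 * lam 0 ≤ lam 1)
    (A : ℝ) (B : Fin 2 → ℝ) {x : ℝ} (hx : 0 < x) (hAB0 : 0 < A * B 0) (hAB1 : 0 < A * B 1)
    (hAF : 0 < A * (A - B 0 * x ^ lam 0 - B 1 * x ^ lam 1)) :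
    0 < rowPsiK7 lam A B x - ((lam 0 : ℝ) ^ 2 + ((lam 1 : ℝ) - lam 0) ^ 2 + (lam 1 : ℝ) ^ 2) * rowPsiK5 lam A B x
          + ((lam 0 : ℝ) ^ 2 * ((lam 1 : ℝ) - lam 0) ^ 2 + (lam 0 : ℝ) ^ 2 * (lam 1 : ℝ) ^ 2
              + ((lam 1 : ℝ) - lam 0) ^ 2 * (lam 1 : ℝ) ^ 2) * rowPsiK3 lam A B x
          - ((lam 0 : ℝ) ^ 2 * ((lam 1 : ℝ) - lam 0) ^ 2 * (lam 1 : ℝ) ^ 2) * rowPsiK1 lam A B x := by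
  rcases pos_and_pos_or_neg_and_neg_of_mul_pos hAB0 with ⟨hA, hB0⟩ | ⟨hA, hB0⟩
  · have hB1 : 0 < B 1 := (pos_iff_pos_of_mul_pos hAB1).mp hA
    have hF : 0 < A - B 0 * x ^ lam 0 - B 1 * x ^ lam 1 := (pos_iff_pos_of_mul_pos hAF).mp hA
    exact rowPsiK_image8_pos_of_cloud_bottom lam h0 h3 A B hx hA hB0 hB1 hF
  · have hB1 : B 1 < 0 := (neg_iff_neg_of_mul_pos hAB1).mp hA
    have hF : A - B 0 * x ^ lam 0 - B 1 * x ^ lam 1 < 0 := (neg_iff_neg_of_mul_pos hAF).mp hA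
    have h := rowPsiK_image8_pos_of_cloud_bottom lam h0 h3 (-A) (fun l => -B l) hx (neg_pos.2 hA)
      (by simpa using neg_pos.2 hB0) (by simpa using neg_pos.2 hB1) (by simp only [neg_mul]; linarith)
    simpa only [rowPsiK7_neg, rowPsiK5_neg, rowPsiK3_neg, rowPsiK1_neg] using h

end ProductPlusOne

end Summit.ValiantsHypothesis.ValiantsHypothesis.Theorems.LacunarySymmetroidMatrixDescartes
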